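import Mathlib
import Summits.NavierStokesRegularity.NavierStokesRegularity.Theorems.ThreadingFluxAzimuthalCartanConicalCorrespondence
import Summits.NavierStokesRegularity.NavierStokesRegularity.Theorems.ThreadingFluxAzimuthalCartanPoiseuilleJordanCalculus
import HarnessLib

/-!
# Crux `PoloidalLiouville` (stmt-NavierStokesRegularity-1222, wall W1), crux idea «azimuthal-cartan-test» (ns-idea-15 g10):
# THE RATIONAL LIOUVILLE WITNESS (K♯ item 2, part 1) — `e^{Φ} = N/D²` is Liouville data on the ball about `(1,1,1)`

Support file (`--supports stmt-NavierStokesRegularity-1222`, helper; cell `ns-wall-extremal`, width hand ns-wall-eng-6 g5, 0 kit).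

The explicit solution of Liouville's equation `−Δ_{S²}φ + 2 = 2e^{φ}` used for K♯ `PoloidalConicalFlows`: with
`N = 9x₀⁴ − 30x₀²x₁² + 48x₀²x₂² + 25x₁⁴ + 80x₁²x₂² + 64x₂⁴ = (3x₀² − 5x₁²)² + 16x₂²(3x₀² + 5x₁² + 4x₂²)` and `D = 9x₀² + x₁² + 4x₂²`,
`e^{Φ} = N/D²` — the conformal factor `|dG|²` of the degree-3 rational self-map `G(z) = z(z² + 2)/(1 + 2z²)` of the Riemann sphere
(which commutes with the antipodal map, so that `|dG|²` pulls back along `x ↦ x/|x|` to an EVEN, i.e. RATIONAL, degree-0 function of `x`;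
`G` has four distinct critical points, the rays `{x₂ = 0, 3x₀² = 5x₁²}` where `N = 0`, so `e^{Φ}` is not rotationally symmetric about any
axis — Šverák's theorem forces every NON-axisymmetric `(−1)`-homogeneous solution to be singular somewhere on `S²`, here on those 4 rays).

* objects: `quartN`, `quadD`, `gradN`, `gradD`, `hessN`, `hessD` (the polynomials and their derivatives), `potential = log N − 2 log D`,
  `grad = ∇N/N − 2∇D/D`, `hess` (its Jacobian, in closed form), the centre `xOne = (1,1,1)` and the ball `coneBall = ball xOne ½`;
* calculus: `hasFDerivAt_quartN/quadD/gradN/gradD/potential/grad`;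
* the three identities: EULER `⟪x, grad x⟫ = 0` (`N`, `D` homogeneous of degrees 4, 2), LIOUVILLE `|x|² tr hess + 2N/D² − 2 = 0`
  (one polynomial identity of degree 12 after clearing `N²D²`), and positivity `N ≥ 64x₂⁴ > 4`, `D > 1` on the ball (all `xᵢ > ½`);
* ★ `liouvilleCone : LiouvilleCone coneBall potential grad hess` — the data of `…ConicalCorrespondence`, so that
  `conicalField potential` is a real-analytic steady NS flow on `coneBall`, unthreaded and `(−1)`-homogeneous about the vertex `0`
  (sequel `…ConicalWitnessNoAxis`: `curl ≠ 0` at `xOne`, NO symmetry axis, and K♯ by name).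

Derivation (local sympy, unmetered; every identity below is re-proved in the kernel by `ring`/`field_simp`): `cas/explore.py`,
`cas/witness.py` of the seat folder.  HONEST FRAME: one explicit local flow; closes no crux; `PoloidalLiouville` (1222) and NS regularity
OPEN / NOT proved.  Sources for the class: Šverák arXiv:math/0604550 §3–§4; Li–Li–Yan arXiv:1609.08197.
-/

-- the summit and its single sub-problem share the name (CONVENTIONS §1)
set_option linter.dupNamespace false

noncomputable section

namespace Summit.NavierStokesRegularity.NavierStokesRegularity.Theorems.PoloidalLiouville.AzimuthalCartan

open Set Function Filter Topology Metric
open scoped ContDiff RealInnerProductSpace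
open Literature.Analysis.FluidPDE
open Summit.NavierStokesRegularity.NavierStokesRegularity.Theorems.PoloidalLiouville.CentreJet (E3)
open Summit.NavierStokesRegularity.NavierStokesRegularity.Theorems.RotatingEulerWindowProfileLinearRung (hasFDerivAt_coord)
open Summit.NavierStokesRegularity.NavierStokesRegularity.Theorems.PoloidalLiouville.AzimuthalCartan.HalfSpace (hasFDerivAt_div)
open Jordan (dx e dx_apply)

namespace ConicalWitness

/-! ### The objects -/

/-- `N = 9x₀⁴ − 30x₀²x₁² + 48x₀²x₂² + 25x₁⁴ + 80x₁²x₂² + 64x₂⁴` (numerator of `e^{Φ}`). -/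
def quartN (x : E3) : ℝ :=
  9 * x 0 ^ 4 - 30 * x 0 ^ 2 * x 1 ^ 2 + 48 * x 0 ^ 2 * x 2 ^ 2 + 25 * x 1 ^ 4 + 80 * x 1 ^ 2 * x 2 ^ 2 + 64 * x 2 ^ 4

/-- `D = 9x₀² + x₁² + 4x₂²` (`e^{Φ} = N/D²`). -/
def quadD (x : E3) : ℝ := 9 * x 0 ^ 2 + x 1 ^ 2 + 4 * x 2 ^ 2

/-- `∇N`. -/
def gradN (x : E3) : E3 :=
  (36 * x 0 ^ 3 - 60 * x 0 * x 1 ^ 2 + 96 * x 0 * x 2 ^ 2) • e 0 + (-60 * x 0 ^ 2 * x 1 + 100 * x 1 ^ 3 + 160 * x 1 * x 2 ^ 2) • e 1 +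
    (96 * x 0 ^ 2 * x 2 + 160 * x 1 ^ 2 * x 2 + 256 * x 2 ^ 3) • e 2

/-- `∇D`. -/
def gradD (x : E3) : E3 := (18 * x 0) • e 0 + (2 * x 1) • e 1 + (8 * x 2) • e 2

/-- `∇²N` as a continuous linear map (rows = covectors). -/
def hessN (x : E3) : E3 →L[ℝ] E3 :=
  ((108 * x 0 ^ 2 - 60 * x 1 ^ 2 + 96 * x 2 ^ 2) • dx 0 + (-120 * x 0 * x 1) • dx 1 + (192 * x 0 * x 2) • dx 2).smulRight (e 0) +
    ((-120 * x 0 * x 1) • dx 0 + (-60 * x 0 ^ 2 + 300 * x 1 ^ 2 + 160 * x 2 ^ 2) • dx 1 + (320 * x 1 * x 2) • dx 2).smulRight (e 1) +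
    ((192 * x 0 * x 2) • dx 0 + (320 * x 1 * x 2) • dx 1 + (96 * x 0 ^ 2 + 160 * x 1 ^ 2 + 768 * x 2 ^ 2) • dx 2).smulRight (e 2)

/-- `∇²D = diag(18, 2, 8)`. -/
def hessD : E3 →L[ℝ] E3 :=
  ((18 : ℝ) • dx 0).smulRight (e 0) + ((2 : ℝ) • dx 1).smulRight (e 1) + ((8 : ℝ) • dx 2).smulRight (e 2)

/-- THE POTENTIAL `Φ = log N − 2 log D` (`e^{Φ} = N/D²`, a solution of `|x|²ΔΦ + 2e^{Φ} − 2 = 0` where `N, D > 0`). -/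
def potential (x : E3) : ℝ := Real.log (quartN x) - 2 * Real.log (quadD x)

/-- Its gradient `g = ∇N/N − 2∇D/D`. -/
def grad (x : E3) : E3 := (quartN x)⁻¹ • gradN x - (2 / quadD x) • gradD x

/-- Its Hessian `H = ∇²N/N − (∇N ⊗ ∇N)/N² − 2∇²D/D + 2(∇D ⊗ ∇D)/D²`. -/
def hess (x : E3) : E3 →L[ℝ] E3 :=
  (quartN x)⁻¹ • hessN x - (quartN x ^ 2)⁻¹ • (innerSL ℝ (gradN x)).smulRight (gradN x) - (2 / quadD x) • hessD +
    (2 / quadD x ^ 2) • (innerSL ℝ (gradD x)).smulRight (gradD x)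

/-- The centre `x₁ = (1, 1, 1)` of the witness ball. -/
def xOne : E3 := WithLp.toLp 2 fun _ => (1 : ℝ)

/-- The witness ball `B(x₁, ½)`: all coordinates exceed `½` on it, so it misses the vertex and the four singular rays `{x₂ = 0, 3x₀² = 5x₁²}`. -/
abbrev coneBall : Set E3 := ball xOne (1 / 2)

/-! ### Coordinates on the ball -/

/-- `x₁ᵢ = 1`. -/
@[simp] theorem xOne_apply (i : Fin 3) : xOne i = 1 := rfl

/-- On the ball every coordinate exceeds `½`. -/
theorem half_lt_apply {x : E3} (hx : x ∈ coneBall) (i : Fin 3) : 1 / 2 < x i := by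
  rw [coneBall, mem_ball, dist_eq_norm] at hx
  have h1 : |x i - 1| < 1 / 2 := by
    have h := PiLp.norm_apply_le (x - xOne) i
    simp only [PiLp.sub_apply, xOne_apply, Real.norm_eq_abs] at h
    exact lt_of_le_of_lt h hx
  have := (abs_lt.1 h1).1
  linarith

/-- `D > 1` on the ball. -/
theorem one_lt_quadD {x : E3} (hx : x ∈ coneBall) : 1 < quadD x := by
  have h0 := half_lt_apply hx 0
  have h1 := half_lt_apply hx 1
  have h2 := half_lt_apply hx 2
  rw [quadD]
  nlinarith

/-- `N > 4` on the ball (`N ≥ 64x₂⁴`). -/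
theorem four_lt_quartN {x : E3} (hx : x ∈ coneBall) : 4 < quartN x := by
  have h2 := half_lt_apply hx 2
  have hsq : 1 / 4 < x 2 ^ 2 := by nlinarith
  have h4 : 1 / 16 < x 2 ^ 4 := by nlinarith
  have hN : 64 * x 2 ^ 4 ≤ quartN x := by
    rw [quartN]
    nlinarith [sq_nonneg (3 * x 0 ^ 2 - 5 * x 1 ^ 2), sq_nonneg (x 0 * x 2), sq_nonneg (x 1 * x 2)]
  linarith

/-- `N ≠ 0` on the ball. -/
theorem quartN_ne_zero {x : E3} (hx : x ∈ coneBall) : quartN x ≠ 0 := by linarith [four_lt_quartN hx]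

/-- `D ≠ 0` on the ball. -/
theorem quadD_ne_zero {x : E3} (hx : x ∈ coneBall) : quadD x ≠ 0 := by linarith [one_lt_quadD hx]

/-- The ball misses the vertex. -/
theorem ne_zero_of_mem {x : E3} (hx : x ∈ coneBall) : x ≠ 0 := by
  intro h
  have := half_lt_apply hx 0
  rw [h] at this
  simp at this
  linarith

/-! ### Polynomial calculus -/

variable (x : E3)

/-- Components of `∇N`. -/
theorem gradN_apply (i : Fin 3) :
    gradN x i = ![36 * x 0 ^ 3 - 60 * x 0 * x 1 ^ 2 + 96 * x 0 * x 2 ^ 2, -60 * x 0 ^ 2 * x 1 + 100 * x 1 ^ 3 + 160 * x 1 * x 2 ^ 2,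
      96 * x 0 ^ 2 * x 2 + 160 * x 1 ^ 2 * x 2 + 256 * x 2 ^ 3] i := by
  fin_cases i <;> simp [gradN]

/-- Components of `∇D`. -/
theorem gradD_apply (i : Fin 3) : gradD x i = ![18 * x 0, 2 * x 1, 8 * x 2] i := by
  fin_cases i <;> simp [gradD]

/-- Components of `∇²N v`. -/
theorem hessN_apply (v : E3) (i : Fin 3) :
    hessN x v i = ![(108 * x 0 ^ 2 - 60 * x 1 ^ 2 + 96 * x 2 ^ 2) * v 0 + (-120 * x 0 * x 1) * v 1 + (192 * x 0 * x 2) * v 2,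
      (-120 * x 0 * x 1) * v 0 + (-60 * x 0 ^ 2 + 300 * x 1 ^ 2 + 160 * x 2 ^ 2) * v 1 + (320 * x 1 * x 2) * v 2,
      (192 * x 0 * x 2) * v 0 + (320 * x 1 * x 2) * v 1 + (96 * x 0 ^ 2 + 160 * x 1 ^ 2 + 768 * x 2 ^ 2) * v 2] i := by
  fin_cases i <;> simp [hessN]

/-- Components of `∇²D v`. -/
theorem hessD_apply (v : E3) (i : Fin 3) : hessD v i = ![18 * v 0, 2 * v 1, 8 * v 2] i := by
  fin_cases i <;> simp [hessD]

/-- `DN = ⟪∇N, ·⟫`. -/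
theorem hasFDerivAt_quartN : HasFDerivAt quartN (innerSL ℝ (gradN x)) x := by
  have h0 := hasFDerivAt_coord 0 x
  have h1 := hasFDerivAt_coord 1 x
  have h2 := hasFDerivAt_coord 2 x
  have h := (((((h0.pow 4).const_mul 9).sub (((h0.pow 2).const_mul 30).mul (h1.pow 2))).add (((h0.pow 2).const_mul 48).mul (h2.pow 2))).add
    ((h1.pow 4).const_mul 25)).add (((h1.pow 2).const_mul 80).mul (h2.pow 2)) |>.add ((h2.pow 4).const_mul 64)
  refine (h.congr_fderiv ?_).congr_of_eventuallyEq (Eventually.of_forall fun y => ?_)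
  · ext v
    simp only [innerSL_apply_apply, PiLp.inner_apply, RCLike.inner_apply, conj_trivial, Fin.sum_univ_three, gradN_apply]
    simp
    ring
  · simp only [quartN, Pi.add_apply, Pi.sub_apply, Pi.mul_apply]

/-- `DD = ⟪∇D, ·⟫`. -/
theorem hasFDerivAt_quadD : HasFDerivAt quadD (innerSL ℝ (gradD x)) x := by
  have h0 := hasFDerivAt_coord 0 x
  have h1 := hasFDerivAt_coord 1 x
  have h2 := hasFDerivAt_coord 2 x
  have h := (((h0.pow 2).const_mul 9).add (h1.pow 2)).add ((h2.pow 2).const_mul 4)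
  refine (h.congr_fderiv ?_).congr_of_eventuallyEq (Eventually.of_forall fun y => ?_)
  · ext v
    simp only [innerSL_apply_apply, PiLp.inner_apply, RCLike.inner_apply, conj_trivial, Fin.sum_univ_three, gradD_apply]
    simp
    ring
  · simp only [quadD, Pi.add_apply]

/-- `D(∇N) = ∇²N`. -/
theorem hasFDerivAt_gradN : HasFDerivAt gradN (hessN x) x := by
  have h0 := hasFDerivAt_coord 0 x
  have h1 := hasFDerivAt_coord 1 x
  have h2 := hasFDerivAt_coord 2 x
  have c0 : HasFDerivAt (fun y : E3 => 36 * y 0 ^ 3 - 60 * y 0 * y 1 ^ 2 + 96 * y 0 * y 2 ^ 2)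
      ((108 * x 0 ^ 2 - 60 * x 1 ^ 2 + 96 * x 2 ^ 2) • dx 0 + (-120 * x 0 * x 1) • dx 1 + (192 * x 0 * x 2) • dx 2) x := by
    have h := (((h0.pow 3).const_mul 36).sub (((h0.const_mul 60).mul (h1.pow 2)))).add ((h0.const_mul 96).mul (h2.pow 2))
    refine h.congr_fderiv ?_
    ext v
    simp
    ring
  have c1 : HasFDerivAt (fun y : E3 => -60 * y 0 ^ 2 * y 1 + 100 * y 1 ^ 3 + 160 * y 1 * y 2 ^ 2)
      ((-120 * x 0 * x 1) • dx 0 + (-60 * x 0 ^ 2 + 300 * x 1 ^ 2 + 160 * x 2 ^ 2) • dx 1 + (320 * x 1 * x 2) • dx 2) x := by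
    have h := ((((h0.pow 2).const_mul (-60)).mul h1).add ((h1.pow 3).const_mul 100)).add ((h1.const_mul 160).mul (h2.pow 2))
    refine h.congr_fderiv ?_
    ext v
    simp
    ring
  have c2 : HasFDerivAt (fun y : E3 => 96 * y 0 ^ 2 * y 2 + 160 * y 1 ^ 2 * y 2 + 256 * y 2 ^ 3)
      ((192 * x 0 * x 2) • dx 0 + (320 * x 1 * x 2) • dx 1 + (96 * x 0 ^ 2 + 160 * x 1 ^ 2 + 768 * x 2 ^ 2) • dx 2) x := by
    have h := ((((h0.pow 2).const_mul 96).mul h2).add (((h1.pow 2).const_mul 160).mul h2)).add ((h2.pow 3).const_mul 256)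
    refine h.congr_fderiv ?_
    ext v
    simp
    ring
  exact ((c0.smul_const (e 0)).add (c1.smul_const (e 1))).add (c2.smul_const (e 2))

/-- `D(∇D) = ∇²D`. -/
theorem hasFDerivAt_gradD : HasFDerivAt gradD hessD x := by
  have h0 := hasFDerivAt_coord 0 x
  have h1 := hasFDerivAt_coord 1 x
  have h2 := hasFDerivAt_coord 2 x
  have h := (((h0.const_mul 18).smul_const (e 0)).add ((h1.const_mul 2).smul_const (e 1))).add ((h2.const_mul 8).smul_const (e 2))
  refine h.congr_fderiv ?_
  simp only [hessD]

/-! ### Euler and Liouville -/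

/-- Euler for `N` (degree 4): `⟪x, ∇N⟫ = 4N`. -/
theorem inner_gradN : ⟪x, gradN x⟫ = 4 * quartN x := by
  simp only [PiLp.inner_apply, RCLike.inner_apply, conj_trivial, Fin.sum_univ_three, gradN_apply, quartN]
  simp
  ring

/-- Euler for `D` (degree 2): `⟪x, ∇D⟫ = 2D`. -/
theorem inner_gradD : ⟪x, gradD x⟫ = 2 * quadD x := by
  simp only [PiLp.inner_apply, RCLike.inner_apply, conj_trivial, Fin.sum_univ_three, gradD_apply, quadD]
  simp
  ring

variable {x}

/-- **EULER**: `⟪x, g x⟫ = 0` (`Φ` is homogeneous of degree `0`). -/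
theorem inner_grad (hx : x ∈ coneBall) : ⟪x, grad x⟫ = 0 := by
  have hN := quartN_ne_zero hx
  have hD := quadD_ne_zero hx
  rw [grad, inner_sub_right, inner_smul_right, inner_smul_right, inner_gradN, inner_gradD]
  field_simp
  ring

/-- The trace of the Hessian in closed form. -/
theorem trace_hess (x : E3) :
    ∑ i, hess x (EuclideanSpace.single i 1) i =
      (quartN x)⁻¹ * (144 * x 0 ^ 2 + 400 * x 1 ^ 2 + 1024 * x 2 ^ 2) -
        (quartN x ^ 2)⁻¹ * ((36 * x 0 ^ 3 - 60 * x 0 * x 1 ^ 2 + 96 * x 0 * x 2 ^ 2) ^ 2 +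
          (-60 * x 0 ^ 2 * x 1 + 100 * x 1 ^ 3 + 160 * x 1 * x 2 ^ 2) ^ 2 + (96 * x 0 ^ 2 * x 2 + 160 * x 1 ^ 2 * x 2 + 256 * x 2 ^ 3) ^ 2) -
        2 / quadD x * 28 + 2 / quadD x ^ 2 * ((18 * x 0) ^ 2 + (2 * x 1) ^ 2 + (8 * x 2) ^ 2) := by
  simp only [hess, Fin.sum_univ_three, add_apply, sub_apply, smul_apply,
    ContinuousLinearMap.smulRight_apply, innerSL_apply_apply, EuclideanSpace.inner_single_right, PiLp.add_apply, PiLp.sub_apply,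
    PiLp.smul_apply, smul_eq_mul, hessN_apply, hessD_apply, gradN_apply, gradD_apply]
  simp
  ring

/-- **LIOUVILLE'S EQUATION in `ℝ³` form**: `|x|² tr H + 2e^{Φ} − 2 = 0` with `e^{Φ} = N/D²` — ONE polynomial identity. -/
theorem liouville_identity (hx : x ∈ coneBall) :
    ‖x‖ ^ 2 * (∑ i, hess x (EuclideanSpace.single i 1) i) + 2 * (quartN x / quadD x ^ 2) - 2 = 0 := by
  have hN := quartN_ne_zero hx
  have hD := quadD_ne_zero hx
  rw [trace_hess, EuclideanSpace.real_norm_sq_eq, Fin.sum_univ_three]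
  field_simp
  simp only [quartN, quadD]
  ring

/-! ### The potential and its derivatives -/

/-- `e^{Φ} = N/D²` on the ball. -/
theorem exp_potential (hx : x ∈ coneBall) : Real.exp (potential x) = quartN x / quadD x ^ 2 := by
  have hN := four_lt_quartN hx
  have hD := one_lt_quadD hx
  rw [potential, Real.exp_sub, Real.exp_log (by linarith), show 2 * Real.log (quadD x) = Real.log (quadD x ^ 2) by
    rw [Real.log_pow]; norm_num, Real.exp_log (by positivity)]

/-- `DΦ = ⟪g, ·⟫` on the ball. -/
theorem hasFDerivAt_potential (hx : x ∈ coneBall) : HasFDerivAt potential (innerSL ℝ (grad x)) x := by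
  have hN := quartN_ne_zero hx
  have hD := quadD_ne_zero hx
  have h := ((hasFDerivAt_quartN x).log hN).sub (((hasFDerivAt_quadD x).log hD).const_mul 2)
  refine h.congr_fderiv ?_
  ext v
  simp only [grad, sub_apply, smul_apply, innerSL_apply_apply, smul_eq_mul, inner_sub_left, inner_smul_left, conj_trivial]
  ring

/-- `Dg = H` on the ball. -/
theorem hasFDerivAt_grad (hx : x ∈ coneBall) : HasFDerivAt grad (hess x) x := by
  have hN := quartN_ne_zero hx
  have hD := quadD_ne_zero hx
  have hinvN : HasFDerivAt (fun y => (quartN y)⁻¹) ((-(quartN x ^ 2)⁻¹) • innerSL ℝ (gradN x)) x :=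
    (hasDerivAt_inv hN).comp_hasFDerivAt x (hasFDerivAt_quartN x)
  have hinvD : HasFDerivAt (fun y => 2 / quadD y) ((quadD x)⁻¹ • (0 : E3 →L[ℝ] ℝ) - (2 / quadD x ^ 2) • innerSL ℝ (gradD x)) x :=
    hasFDerivAt_div (hasFDerivAt_const (2 : ℝ) x) (hasFDerivAt_quadD x) hD
  have h := (hinvN.smul (hasFDerivAt_gradN x)).sub (hinvD.smul (hasFDerivAt_gradD x))
  refine h.congr_fderiv ?_
  ext v i
  simp only [hess, add_apply, sub_apply, smul_apply, neg_apply, ContinuousLinearMap.smulRight_apply, innerSL_apply_apply,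
    PiLp.add_apply, PiLp.sub_apply, PiLp.smul_apply, smul_eq_mul, smul_zero, zero_sub]
  ring

/-! ### Analyticity -/

/-- The coordinates are `C^ω`. -/
theorem contDiff_coord (i : Fin 3) : ContDiff ℝ (⊤ : WithTop ℕ∞) (fun y : E3 => y i) :=
  (EuclideanSpace.proj i : E3 →L[ℝ] ℝ).contDiff

/-- `N` is `C^ω`. -/
theorem contDiff_quartN : ContDiff ℝ (⊤ : WithTop ℕ∞) quartN := by
  have h0 := contDiff_coord 0
  have h1 := contDiff_coord 1
  have h2 := contDiff_coord 2
  exact ((((((contDiff_const.mul (h0.pow 4)).sub ((contDiff_const.mul (h0.pow 2)).mul (h1.pow 2))).add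
    ((contDiff_const.mul (h0.pow 2)).mul (h2.pow 2))).add (contDiff_const.mul (h1.pow 4))).add
    ((contDiff_const.mul (h1.pow 2)).mul (h2.pow 2))).add (contDiff_const.mul (h2.pow 4)))

/-- `D` is `C^ω`. -/
theorem contDiff_quadD : ContDiff ℝ (⊤ : WithTop ℕ∞) quadD := by
  have h0 := contDiff_coord 0
  have h1 := contDiff_coord 1
  have h2 := contDiff_coord 2
  exact ((contDiff_const.mul (h0.pow 2)).add (h1.pow 2)).add (contDiff_const.mul (h2.pow 2))

/-- `Φ` is real-analytic on the ball. -/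
theorem analyticAt_potential (hx : x ∈ coneBall) : AnalyticAt ℝ potential x := by
  have hN : 0 < quartN x := by linarith [four_lt_quartN hx]
  have hD : 0 < quadD x := by linarith [one_lt_quadD hx]
  exact ((analyticAt_log hN).comp contDiff_quartN.contDiffAt.analyticAt).sub
    (analyticAt_const.mul ((analyticAt_log hD).comp contDiff_quadD.contDiffAt.analyticAt))

/-! ### The Liouville data -/

/-- `coneBall` is open. -/
theorem isOpen_coneBall : IsOpen coneBall := isOpen_ball

/-- ★ **The rational witness is Liouville data on the ball** (the hypotheses of the conical correspondence). -/
theorem liouvilleCone : LiouvilleCone coneBall potential grad hess where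
  isOpen := isOpen_coneBall
  ne_zero := fun _ hy => ne_zero_of_mem hy
  analyticOnNhd := fun _ hy => analyticAt_potential hy
  hasFDerivAt_potential := fun _ hy => hasFDerivAt_potential hy
  hasFDerivAt_gradient := fun _ hy => hasFDerivAt_grad hy
  euler := fun _ hy => inner_grad hy
  liouville := fun y hy => by rw [exp_potential hy]; exact liouville_identity hy

end ConicalWitness

end Summit.NavierStokesRegularity.NavierStokesRegularity.Theorems.PoloidalLiouville.AzimuthalCartan

end
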